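import Summits.AtomisticToContinuum.Crystallization.Theorems.FreeSplittingCertificatesStrictSplittingRuleP1Far

/-!
# `StrictSplittingRule` (stmt-AtomisticToContinuum-12560): SIZE of the cells of the P1 interpolant — every real cell lies within sup-distance `2|a| + |h|` of its base site (P1 interpolant object, part 9)

Route `FreeSplittingCertificates`, crux r3 `StrictSplittingRule` (H12⋆ = `stub_coreJointCoercive`), unit b2b-freesplit-B gen 20.
VALUE = a bookkeeping brick for item (2') of HOME FAR-LEMMA-SPEC §16 (c) (weight variation `|x|⁻⁶` across an element, allocation of cells to
radial shells): NOT a proof of H12⋆, NOT summit progress.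

* `abs_sub_le_of_mem_p1RealCell` / `norm_sub_le_of_mem_p1RealCell`: for `y ∈ p1RealCell a h (n, π)`, componentwise
  `|y_j − (y_n)_j| ≤ 2|a| + |h|` and `‖y − y_n‖_∞ ≤ 2|a| + |h|`, where `y_n = hcpSite a h n` is the cube-origin site of the cell (a vertex of
  the cube, at sup-distance `≤ 2|a| + |h|` from every vertex of the cell as well);
* `norm_vertex_sub_le_of_p1RealCell`: the same for the four vertices `y_{n + v_m}`;
so on a cell all weights `|x|^{-k}` are pinched between their values at `‖y_n‖ ± (2|a|+|h|)` — the "weight variation across an element"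
factor of the transfer is controlled by the explicit cell size.  [folklore]
-/

noncomputable section

open Set Function Metric

namespace Summit.AtomisticToContinuum.Crystallization.Theorems.StrictSplittingRuleBirth

open Summit.AtomisticToContinuum.Crystallization.Theorems.PalmUnimodularRigidity.LayeredLawsSelectHcp (hcpSite)

/-- `√3 ≤ 2`. -/
theorem sqrt_three_le_two : (√3 : ℝ) ≤ 2 := by
  rw [show (2 : ℝ) = √4 by rw [show (4 : ℝ) = 2 ^ 2 by norm_num, Real.sqrt_sq (by norm_num)]]
  exact Real.sqrt_le_sqrt (by norm_num)

/-- **Chart increments over a unit cube are small**: if `q − p ∈ [0,1]³` (coordinatewise) then `|T q j − T p j| ≤ 2|a| + |h|` for every `j`. -/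
theorem abs_p1Chart_sub_le (a h : ℝ) {p q : Fin 3 → ℝ} (hpq : ∀ i, p i ≤ q i ∧ q i ≤ p i + 1) (j : Fin 3) :
    |p1Chart a h q j - p1Chart a h p j| ≤ 2 * |a| + |h| := by
  have hTq := p1Tent_mem_Icc (q 0)
  have hTp := p1Tent_mem_Icc (p 0)
  have h0 := hpq 0; have h1 := hpq 1; have h2 := hpq 2
  have ha := abs_nonneg a
  have hh := abs_nonneg h
  have h3 := sqrt_three_le_two
  have h3' : 0 ≤ (√3 : ℝ) := Real.sqrt_nonneg 3
  fin_cases j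
  · simp only [Fin.zero_eta, p1Chart_apply_zero]
    rw [← mul_sub, abs_mul]
    have : |q 1 + q 2 / 2 + p1Tent (q 0) / 2 - (p 1 + p 2 / 2 + p1Tent (p 0) / 2)| ≤ 2 := by
      rw [abs_le]; constructor <;> linarith [hTq.1, hTq.2, hTp.1, hTp.2]
    calc |a| * |q 1 + q 2 / 2 + p1Tent (q 0) / 2 - (p 1 + p 2 / 2 + p1Tent (p 0) / 2)| ≤ |a| * 2 := by gcongr
      _ ≤ 2 * |a| + |h| := by linarith
  · simp only [Fin.mk_one, p1Chart_apply_one]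
    rw [← mul_sub, abs_mul, abs_div, abs_mul, abs_two, abs_of_nonneg h3']
    have : |q 2 + p1Tent (q 0) / 3 - (p 2 + p1Tent (p 0) / 3)| ≤ 4 / 3 := by
      rw [abs_le]; constructor <;> linarith [hTq.1, hTq.2, hTp.1, hTp.2]
    calc |a| * √3 / 2 * |q 2 + p1Tent (q 0) / 3 - (p 2 + p1Tent (p 0) / 3)| ≤ |a| * 2 / 2 * (4 / 3) := by gcongr
      _ ≤ 2 * |a| + |h| := by linarith
  · simp only [Fin.reduceFinMk, p1Chart_apply_two]
    rw [← sub_mul, abs_mul]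
    have : |q 0 - p 0| ≤ 1 := by rw [abs_le]; constructor <;> linarith
    calc |q 0 - p 0| * |h| ≤ 1 * |h| := by gcongr
      _ ≤ 2 * |a| + |h| := by linarith

/-- **Cell size, componentwise**: every point of the real cell `(n, π)` is within `2|a| + |h|` of the cube-origin site `y_n` in each coordinate. -/
theorem abs_sub_le_of_mem_p1RealCell {a h : ℝ} (ha : a ≠ 0) (hh : h ≠ 0) {i : (ℤ × ℤ × ℤ) × Fin 6} {y : Fin 3 → ℝ}
    (hy : y ∈ p1RealCell a h i) (j : Fin 3) : |y j - hcpSite a h i.1 j| ≤ 2 * |a| + |h| := by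
  have hq : p1ChartInv a h y ∈ p1Cell i := hy
  have hcube := p1Cell_subset_cube hq
  have hy' : y = p1Chart a h (p1ChartInv a h y) := (p1Chart_p1ChartInv ha hh y).symm
  rw [← p1Chart_p1Vec a h i.1 j]
  conv_lhs => rw [hy']
  exact abs_p1Chart_sub_le a h (fun k => hcube k) j

/-- **Cell size in sup norm**: `‖y − y_n‖ ≤ 2|a| + |h|` on the real cell `(n, π)`. -/
theorem norm_sub_le_of_mem_p1RealCell {a h : ℝ} (ha : a ≠ 0) (hh : h ≠ 0) {i : (ℤ × ℤ × ℤ) × Fin 6} {y : Fin 3 → ℝ}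
    (hy : y ∈ p1RealCell a h i) : ‖y - fun j => hcpSite a h i.1 j‖ ≤ 2 * |a| + |h| := by
  refine (pi_norm_le_iff_of_nonneg (by positivity)).2 fun j => ?_
  rw [Real.norm_eq_abs]
  exact abs_sub_le_of_mem_p1RealCell ha hh hy j

/-- The vertices of a cell are within `2|a| + |h|` of its cube-origin site, componentwise. -/
theorem abs_vertex_sub_le (a h : ℝ) (i : (ℤ × ℤ × ℤ) × Fin 6) (m : Fin 4) (j : Fin 3) :
    |hcpSite a h (i.1 + p1VertOff (p1Par i.1) i.2 m) j - hcpSite a h i.1 j| ≤ 2 * |a| + |h| := by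
  rw [← p1Chart_p1Vec a h _ j, ← p1Chart_p1Vec a h i.1 j]
  refine abs_p1Chart_sub_le a h (fun k => ?_) j
  have hm := p1VertOff_mem (p1Par i.1) i.2 m
  rw [p1Vec_add, Pi.add_apply]
  fin_cases k
  · rcases hm.1 with h0 | h0 <;> simp [h0]
  · rcases hm.2.1 with h0 | h0 <;> simp [h0]
  · rcases hm.2.2 with h0 | h0 <;> simp [h0]

/-- **Cell size from a vertex**: every point of the real cell is within `2·(2|a| + |h|)` of each of its vertices `y_{n+v_m}`, componentwise. -/
theorem abs_sub_vertex_le_of_mem_p1RealCell {a h : ℝ} (ha : a ≠ 0) (hh : h ≠ 0) {i : (ℤ × ℤ × ℤ) × Fin 6} {y : Fin 3 → ℝ}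
    (hy : y ∈ p1RealCell a h i) (m : Fin 4) (j : Fin 3) :
    |y j - hcpSite a h (i.1 + p1VertOff (p1Par i.1) i.2 m) j| ≤ 2 * (2 * |a| + |h|) := by
  have h1 := abs_sub_le_of_mem_p1RealCell ha hh hy j
  have h2 := abs_vertex_sub_le a h i m j
  rw [abs_le] at h1 h2 ⊢
  constructor <;> linarith [h1.1, h1.2, h2.1, h2.2]

end Summit.AtomisticToContinuum.Crystallization.Theorems.StrictSplittingRuleBirth
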